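import Mathlib
import HarnessLib
import Summits.Ventures.LatticeQCDFlow.Scoring.GlivenkoCantelliSandwich
import Summits.Ventures.LatticeQCDFlow.Scoring.SelfNormalisedReweightingConsistency

/-!
# The Glivenko–Cantelli theorem — classical (a pairwise independent, identically distributed real
# sequence) and REWEIGHTED (the self-normalised empirical distribution function of a statistic
# printed by a flow card along one proposal stream): almost surely `sup_t |F̂ₙ(t) − F(t)| → 0`

HONEST FRAMING: exact (Metropolis-corrected) sampling algorithms for lattice gauge theory;
figures of merit are autocorrelation/cost numbers at stated couplings and volumes; no
continuum-physics claim.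

Venture `LatticeQCDFlow` (cell pub-lqcd), topic `Scoring`; FANOUT row 4 (`s0-u1-b`, rung S0-B:
two independent codes compared column by column).  Sequel of `Scoring/GlivenkoCantelliSandwich`
(the deterministic sandwich: monotone `[0,1]`-valued `F̂ₙ` with strict companions `Ĝₙ` that
converge at the quantile grid converge uniformly) and of
`Scoring/SelfNormalisedReweightingConsistency` (the printed self-normalised reweighting estimate
of ANY integrable observable is strongly consistent along one proposal stream), both imported.
Reading an indicator `1{O ≤ t}` as the observable gives pointwise consistency of the reweighted
empirical distribution function
`F̂ₙ(t) = Σ_{i<n} w̃ᵢ·1{O(yᵢ) ≤ t} / Σ_{i<n} w̃ᵢ` (and of `Ĝₙ(t)`, with `<`) at each fixed `t`;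
countably many `t` — the quantile grid of the target law `ρ = (p dμ) ∘ O⁻¹` — hold simultaneously
almost surely, and the sandwich upgrades this to UNIFORM convergence:
**`reweightedGlivenkoCantelli_ae`**.  With equal weights the same two steps (Mathlib's strong law
`strong_law_ae_real`, pairwise independence suffices) give the CLASSICAL Glivenko–Cantelli theorem
**`glivenkoCantelli_ae`**, which Mathlib does not have.  Printed counterparts NAMED ONLY
(nothing cited as a fact): Glivenko, *Sulla determinazione empirica delle leggi di probabilità*,
Giorn. Ist. Ital. Attuari 4 (1933) 92–99; Cantelli, ibid. 421–424; van der Vaart, *Asymptotic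
Statistics* (1998) Thm 19.1; for self-normalised importance weights, the weighted-empirical-
measure folklore (Owen, *Monte Carlo theory, methods and examples* (2013) §9.2).  NEW WORK of the
cell (our formalisation); no definition is introduced.

## Content

§1 `indicator_Iic_mono`, `indicator_one_le_one` — bookkeeping.
§2 classical: `empiricalFrequency_tendsto_ae` (`#{i<n : Xᵢ ∈ I}/n → ρ(I)` a.s. for a measurable
`I`, `ρ` the common law), **`glivenkoCantelli_ae`** (`TendstoUniformly (n ↦ F̂ₙ) (cdf ρ)` a.s.).
§3 reweighted (one proposal stream `yᵢ` with laws `q dμ`, weights `w̃ = c·p/q`, `c > 0`, target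
`p ≥ 0`, `∫ p dμ = 1`, statistic `O` measurable): `isProbabilityMeasure_targetLaw`,
`integral_target_indicator_eq` (`∫ p·1{O ∈ I} dμ = ρ(I)`, `ρ = (p dμ)∘O⁻¹`),
`reweightedFrequency_tendsto_ae`, **`reweightedGlivenkoCantelli_ae`**.

NOT CLAIMED: any rate (Dvoretzky–Kiefer–Wolfowitz / Massart need the moment ladder); dependence
along a Markov chain (the chain-side column); multivariate statistics; any number of ours
re-scored.
-/

noncomputable section

namespace Summit.Ventures.LatticeQCDFlow.Scoring.GlivenkoCantelli

open MeasureTheory ProbabilityTheory Finset Filter Function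
open scoped Topology

/-! ## §1 Bookkeeping on indicators -/

section Indicator

/-- `t ↦ 1{a ≤ t}` is monotone. [folklore] -/
theorem indicator_Iic_mono (a : ℝ) : Monotone fun t : ℝ => (Set.Iic t).indicator (1 : ℝ → ℝ) a :=
  fun _ _ hst => Set.indicator_le_indicator_of_subset (Set.Iic_subset_Iic.2 hst)
    (fun _ => zero_le_one) a

/-- `1{a ∈ I} ≤ 1`. [folklore] -/
theorem indicator_one_le_one (I : Set ℝ) (a : ℝ) : I.indicator (1 : ℝ → ℝ) a ≤ 1 :=
  Set.indicator_apply_le' (fun _ => le_rfl) fun _ => zero_le_one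

/-- `0 ≤ 1{a ∈ I}`. [folklore] -/
theorem indicator_one_nonneg (I : Set ℝ) (a : ℝ) : 0 ≤ I.indicator (1 : ℝ → ℝ) a :=
  Set.indicator_nonneg (fun _ _ => zero_le_one) a

/-- `1{a ≤ s} ≤ 1{a < t}` for `s < t`. [folklore] -/
theorem indicator_Iic_le_Iio {s t : ℝ} (hst : s < t) (a : ℝ) :
    (Set.Iic s).indicator (1 : ℝ → ℝ) a ≤ (Set.Iio t).indicator (1 : ℝ → ℝ) a :=
  Set.indicator_le_indicator_of_subset (Set.Iic_subset_Iio.2 hst) (fun _ => zero_le_one) a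

end Indicator

/-! ## §2 The classical Glivenko–Cantelli theorem -/

section Classical

variable {Ω : Type*} [MeasurableSpace Ω] {P : Measure Ω} {X : ℕ → Ω → ℝ}

/-- **Empirical frequencies are strongly consistent**: for a pairwise independent, identically
distributed real sequence `Xᵢ` with common law `ρ = P ∘ X₀⁻¹` and a measurable `I ⊆ ℝ`, almost
surely `#{i < n : Xᵢ ∈ I}/n → ρ(I)`. [folklore] (Mathlib's strong law for the indicators) -/
theorem empiricalFrequency_tendsto_ae [IsFiniteMeasure P] (hind : Pairwise ((· ⟂ᵢ[P] ·) on X))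
    (hid : ∀ i, IdentDistrib (X i) (X 0) P P) {I : Set ℝ} (hI : MeasurableSet I) :
    ∀ᵐ ω ∂P, Tendsto (fun n : ℕ => (∑ i ∈ range n, I.indicator (1 : ℝ → ℝ) (X i ω)) / n) atTop
      (𝓝 ((P.map (X 0)).real I)) := by
  have hgm : Measurable (I.indicator (1 : ℝ → ℝ)) := measurable_one.indicator hI
  have hX0 : AEMeasurable (X 0) P := (hid 0).aemeasurable_fst
  have hint : Integrable (fun ω => I.indicator (1 : ℝ → ℝ) (X 0 ω)) P := by
    refine (integrable_const (1 : ℝ)).mono' (hgm.comp_aemeasurable hX0).aestronglyMeasurable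
      (Eventually.of_forall fun ω => ?_)
    rw [Real.norm_eq_abs, abs_of_nonneg (indicator_one_nonneg I _)]
    exact indicator_one_le_one I _
  have h := strong_law_ae_real (fun i ω => I.indicator (1 : ℝ → ℝ) (X i ω)) hint
    (fun i j hij => (hind hij).comp hgm hgm) (fun i => (hid i).comp hgm)
  have e : ∫ ω, I.indicator (1 : ℝ → ℝ) (X 0 ω) ∂P = (P.map (X 0)).real I := by
    rw [← integral_map hX0 hgm.aestronglyMeasurable]
    exact integral_indicator_one hI
  rw [e] at h
  exact h

/-- **THE GLIVENKO–CANTELLI THEOREM.**  For a pairwise independent, identically distributed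
sequence of real random variables `Xᵢ` on a probability space, with common law `ρ = P ∘ X₀⁻¹`
and distribution function `F = cdf ρ`, the empirical distribution functions
`F̂ₙ(t) = #{i < n : Xᵢ ≤ t}/n` converge to `F` UNIFORMLY on `ℝ`, almost surely:
`P(sup_t |F̂ₙ(t) − F(t)| → 0) = 1`. [ours] (our formalisation of the classical proof: the strong
law at the countably many points of the quantile grid, for `≤` and for `<`, then the deterministic
sandwich `tendstoUniformly_cdf_of_tendsto_grid`) -/
theorem glivenkoCantelli_ae [IsProbabilityMeasure P] (hind : Pairwise ((· ⟂ᵢ[P] ·) on X))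
    (hid : ∀ i, IdentDistrib (X i) (X 0) P P) :
    ∀ᵐ ω ∂P, TendstoUniformly
      (fun (n : ℕ) (t : ℝ) => (∑ i ∈ range n, (Set.Iic t).indicator (1 : ℝ → ℝ) (X i ω)) / n)
      (cdf (P.map (X 0))) atTop := by
  haveI : IsProbabilityMeasure (P.map (X 0)) :=
    Measure.isProbabilityMeasure_map (hid 0).aemeasurable_fst
  -- pointwise consistency for `≤ t` and `< t`, at every fixed `t`
  have hF : ∀ t : ℝ, ∀ᵐ ω ∂P, Tendsto (fun n : ℕ =>
      (∑ i ∈ range n, (Set.Iic t).indicator (1 : ℝ → ℝ) (X i ω)) / n) atTop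
      (𝓝 (cdf (P.map (X 0)) t)) := fun t => by
    rw [cdf_eq_real]
    exact empiricalFrequency_tendsto_ae hind hid measurableSet_Iic
  have hG : ∀ t : ℝ, ∀ᵐ ω ∂P, Tendsto (fun n : ℕ =>
      (∑ i ∈ range n, (Set.Iio t).indicator (1 : ℝ → ℝ) (X i ω)) / n) atTop
      (𝓝 (leftLim (cdf (P.map (X 0))) t)) := fun t => by
    rw [leftLim_cdf_eq_real]
    exact empiricalFrequency_tendsto_ae hind hid measurableSet_Iio
  -- simultaneously at the countably many points of the quantile grid
  have hall : ∀ᵐ ω ∂P, ∀ k j : ℕ,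
      Tendsto (fun n : ℕ => (∑ i ∈ range n,
          (Set.Iic (sInf {x | (j : ℝ) / k ≤ cdf (P.map (X 0)) x})).indicator (1 : ℝ → ℝ)
            (X i ω)) / n) atTop
        (𝓝 (cdf (P.map (X 0)) (sInf {x | (j : ℝ) / k ≤ cdf (P.map (X 0)) x})))
      ∧ Tendsto (fun n : ℕ => (∑ i ∈ range n,
          (Set.Iio (sInf {x | (j : ℝ) / k ≤ cdf (P.map (X 0)) x})).indicator (1 : ℝ → ℝ)
            (X i ω)) / n) atTop
        (𝓝 (leftLim (cdf (P.map (X 0))) (sInf {x | (j : ℝ) / k ≤ cdf (P.map (X 0)) x}))) := by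
    rw [ae_all_iff]
    intro k
    rw [ae_all_iff]
    intro j
    exact (hF _).and (hG _)
  filter_upwards [hall] with ω hω
  refine tendstoUniformly_cdf_of_tendsto_grid (P.map (X 0))
    (G := fun n t => (∑ i ∈ range n, (Set.Iio t).indicator (1 : ℝ → ℝ) (X i ω)) / n)
    (fun n u t hut => ?_) (fun n t => ?_) (fun n t => ?_) (fun n s t hst => ?_)
    (fun k j => (hω k j).1) fun k j => (hω k j).2
  · exact div_le_div_of_nonneg_right (sum_le_sum fun i _ => indicator_Iic_mono _ hut)
      (Nat.cast_nonneg n)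
  · exact div_nonneg (sum_nonneg fun i _ => indicator_one_nonneg _ _) (Nat.cast_nonneg n)
  · refine div_le_one_of_le₀ ((sum_le_sum fun i _ => indicator_one_le_one _ _).trans ?_)
      (Nat.cast_nonneg n)
    simp
  · exact div_le_div_of_nonneg_right (sum_le_sum fun i _ => indicator_Iic_le_Iio hst _)
      (Nat.cast_nonneg n)

end Classical

/-! ## §3 The reweighted Glivenko–Cantelli theorem for a flow card's printed statistic -/

section Reweighted

variable {Ω : Type*} [MeasurableSpace Ω] {P : Measure Ω}
variable {X : Type*} [MeasurableSpace X] {μ : Measure X} {p q O : X → ℝ} {y : ℕ → Ω → X}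

/-- The target law `ρ = (p dμ) ∘ O⁻¹` of a measurable statistic `O` under a normalised
non-negative density `p` is a probability measure. [folklore] -/
theorem isProbabilityMeasure_targetLaw (hp0 : ∀ z, 0 ≤ p z) (hpi : Integrable p μ)
    (hp1 : ∫ z, p z ∂μ = 1) (hOm : Measurable O) :
    IsProbabilityMeasure ((μ.withDensity fun z => ENNReal.ofReal (p z)).map O) := by
  haveI : IsProbabilityMeasure (μ.withDensity fun z => ENNReal.ofReal (p z)) := by
    refine ⟨?_⟩
    rw [withDensity_apply _ MeasurableSet.univ, Measure.restrict_univ,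
      ← ofReal_integral_eq_lintegral_ofReal hpi (Eventually.of_forall hp0), hp1,
      ENNReal.ofReal_one]
  exact Measure.isProbabilityMeasure_map hOm.aemeasurable

/-- `∫ p·1{O ∈ I} dμ = ρ(I)` for the target law `ρ = (p dμ) ∘ O⁻¹` and a measurable `I ⊆ ℝ`.
[folklore] -/
theorem integral_target_indicator_eq (hp0 : ∀ z, 0 ≤ p z) (hpm : Measurable p)
    (hOm : Measurable O) {I : Set ℝ} (hI : MeasurableSet I) :
    ∫ z, p z * I.indicator (1 : ℝ → ℝ) (O z) ∂μ
      = ((μ.withDensity fun z => ENNReal.ofReal (p z)).map O).real I := by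
  have e1 : (fun z => p z * I.indicator (1 : ℝ → ℝ) (O z))
      = fun z => I.indicator (1 : ℝ → ℝ) (O z) * p z := funext fun z => mul_comm _ _
  rw [e1, ← AllPairsVariance.integral_withDensity_eq' hp0 hpm,
    ← integral_map hOm.aemeasurable (measurable_one.indicator hI).aestronglyMeasurable]
  exact integral_indicator_one hI

/-- `p·1{O ∈ I} ∈ L¹(μ)` for an integrable target. [folklore] -/
theorem integrable_target_indicator (hpm : Measurable p) (hpi : Integrable p μ)
    (hOm : Measurable O) {I : Set ℝ} (hI : MeasurableSet I) :
    Integrable (fun z => p z * I.indicator (1 : ℝ → ℝ) (O z)) μ := by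
  refine Integrable.mono' hpi.norm
    ((hpm.mul ((measurable_one.indicator hI).comp hOm)).aestronglyMeasurable)
    (Eventually.of_forall fun z => ?_)
  rw [Real.norm_eq_abs, Real.norm_eq_abs, abs_mul]
  refine mul_le_of_le_one_right (abs_nonneg _) ?_
  rw [abs_of_nonneg (indicator_one_nonneg I _)]
  exact indicator_one_le_one I _

/-- **Reweighted frequencies are strongly consistent**: one independent proposal stream `yᵢ`
(laws `q dμ`), `p` measurable, integrable, `∫ p dμ = 1`, `q > 0` measurable, `O` measurable,
weights `w̃ = c·p/q` with `c ≠ 0`; for a measurable `I ⊆ ℝ`, almost surely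
`Σ_{i<n} w̃ᵢ·1{O(yᵢ) ∈ I} / Σ_{i<n} w̃ᵢ → ∫ p·1{O ∈ I} dμ`. [ours]
(`CardConsistency.selfNormReweighting_tendsto_ae` for the indicator observable) -/
theorem reweightedFrequency_tendsto_ae (hym : ∀ j, Measurable (y j)) (hind : iIndepFun y P)
    (hlaw : ∀ j, Measure.map (y j) P = μ.withDensity fun z => ENNReal.ofReal (q z))
    (hpm : Measurable p) (hpi : Integrable p μ) (hp1 : ∫ z, p z ∂μ = 1) (hq0 : ∀ z, 0 < q z)
    (hqm : Measurable q) (hOm : Measurable O) {wt : X → ℝ} {c : ℝ} (hc : c ≠ 0)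
    (hwt : ∀ z, wt z = c * (p z / q z)) {I : Set ℝ} (hI : MeasurableSet I) :
    ∀ᵐ ω ∂P, Tendsto (fun n : ℕ =>
        (∑ i ∈ range n, wt (y i ω) * I.indicator (1 : ℝ → ℝ) (O (y i ω)))
          / (∑ i ∈ range n, wt (y i ω))) atTop
      (𝓝 (∫ z, p z * I.indicator (1 : ℝ → ℝ) (O z) ∂μ)) :=
  CardConsistency.selfNormReweighting_tendsto_ae hym hind hlaw hpm hpi hp1 hq0 hqm
    ((measurable_one.indicator hI).comp hOm) (integrable_target_indicator hpm hpi hOm hI) hc hwt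

/-- **THE REWEIGHTED GLIVENKO–CANTELLI THEOREM (the printed empirical distribution function of a
continuous statistic is uniformly consistent).**  One independent proposal stream `yᵢ` (laws
`μ.withDensity q`); target `p ≥ 0` measurable, integrable, `∫ p dμ = 1`; `q > 0` measurable; a
measurable real statistic `O` (plaquette, action density, a Wilson loop, …) with target law
`ρ = (p dμ) ∘ O⁻¹` and distribution function `F = cdf ρ`; weights printed with any
normalisation `w̃ = c·p/q`, `c > 0`.  Then almost surely the printed reweighted empirical
distribution functions `F̂ₙ(t) = Σ_{i<n} w̃ᵢ·1{O(yᵢ) ≤ t} / Σ_{i<n} w̃ᵢ` converge to `F`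
UNIFORMLY on `ℝ` — no moment hypothesis on the weights (the effective sample size may be `0`),
no ceiling. [ours] -/
theorem reweightedGlivenkoCantelli_ae (hym : ∀ j, Measurable (y j)) (hind : iIndepFun y P)
    (hlaw : ∀ j, Measure.map (y j) P = μ.withDensity fun z => ENNReal.ofReal (q z))
    (hp0 : ∀ z, 0 ≤ p z) (hpm : Measurable p) (hpi : Integrable p μ) (hp1 : ∫ z, p z ∂μ = 1)
    (hq0 : ∀ z, 0 < q z) (hqm : Measurable q) (hOm : Measurable O) {wt : X → ℝ} {c : ℝ}
    (hc : 0 < c) (hwt : ∀ z, wt z = c * (p z / q z)) :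
    ∀ᵐ ω ∂P, TendstoUniformly
      (fun (n : ℕ) (t : ℝ) =>
        (∑ i ∈ range n, wt (y i ω) * (Set.Iic t).indicator (1 : ℝ → ℝ) (O (y i ω)))
          / (∑ i ∈ range n, wt (y i ω)))
      (cdf ((μ.withDensity fun z => ENNReal.ofReal (p z)).map O)) atTop := by
  haveI := isProbabilityMeasure_targetLaw (μ := μ) hp0 hpi hp1 hOm
  set ρ : Measure ℝ := (μ.withDensity fun z => ENNReal.ofReal (p z)).map O with hρ
  have hwt0 : ∀ z, 0 ≤ wt z := fun z => by
    rw [hwt]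
    exact mul_nonneg hc.le (div_nonneg (hp0 z) (hq0 z).le)
  -- pointwise consistency for `≤ t` and `< t`, at every fixed `t`
  have hF : ∀ t : ℝ, ∀ᵐ ω ∂P, Tendsto (fun n : ℕ =>
      (∑ i ∈ range n, wt (y i ω) * (Set.Iic t).indicator (1 : ℝ → ℝ) (O (y i ω)))
        / (∑ i ∈ range n, wt (y i ω))) atTop (𝓝 (cdf ρ t)) := fun t => by
    rw [cdf_eq_real, hρ, ← integral_target_indicator_eq hp0 hpm hOm measurableSet_Iic]
    exact reweightedFrequency_tendsto_ae hym hind hlaw hpm hpi hp1 hq0 hqm hOm hc.ne' hwt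
      measurableSet_Iic
  have hG : ∀ t : ℝ, ∀ᵐ ω ∂P, Tendsto (fun n : ℕ =>
      (∑ i ∈ range n, wt (y i ω) * (Set.Iio t).indicator (1 : ℝ → ℝ) (O (y i ω)))
        / (∑ i ∈ range n, wt (y i ω))) atTop (𝓝 (leftLim (cdf ρ) t)) := fun t => by
    rw [leftLim_cdf_eq_real, hρ, ← integral_target_indicator_eq hp0 hpm hOm measurableSet_Iio]
    exact reweightedFrequency_tendsto_ae hym hind hlaw hpm hpi hp1 hq0 hqm hOm hc.ne' hwt
      measurableSet_Iio
  -- simultaneously at the countably many points of the quantile grid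
  have hall : ∀ᵐ ω ∂P, ∀ k j : ℕ,
      Tendsto (fun n : ℕ => (∑ i ∈ range n, wt (y i ω) *
          (Set.Iic (sInf {x | (j : ℝ) / k ≤ cdf ρ x})).indicator (1 : ℝ → ℝ) (O (y i ω)))
            / (∑ i ∈ range n, wt (y i ω))) atTop
        (𝓝 (cdf ρ (sInf {x | (j : ℝ) / k ≤ cdf ρ x})))
      ∧ Tendsto (fun n : ℕ => (∑ i ∈ range n, wt (y i ω) *
          (Set.Iio (sInf {x | (j : ℝ) / k ≤ cdf ρ x})).indicator (1 : ℝ → ℝ) (O (y i ω)))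
            / (∑ i ∈ range n, wt (y i ω))) atTop
        (𝓝 (leftLim (cdf ρ) (sInf {x | (j : ℝ) / k ≤ cdf ρ x}))) := by
    rw [ae_all_iff]
    intro k
    rw [ae_all_iff]
    intro j
    exact (hF _).and (hG _)
  filter_upwards [hall] with ω hω
  refine tendstoUniformly_cdf_of_tendsto_grid ρ
    (G := fun n t => (∑ i ∈ range n, wt (y i ω) *
      (Set.Iio t).indicator (1 : ℝ → ℝ) (O (y i ω))) / (∑ i ∈ range n, wt (y i ω)))
    (fun n u t hut => ?_) (fun n t => ?_) (fun n t => ?_) (fun n s t hst => ?_)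
    (fun k j => (hω k j).1) fun k j => (hω k j).2
  · exact div_le_div_of_nonneg_right
      (sum_le_sum fun i _ => mul_le_mul_of_nonneg_left (indicator_Iic_mono _ hut) (hwt0 _))
      (sum_nonneg fun i _ => hwt0 _)
  · exact div_nonneg (sum_nonneg fun i _ => mul_nonneg (hwt0 _) (indicator_one_nonneg _ _))
      (sum_nonneg fun i _ => hwt0 _)
  · refine div_le_one_of_le₀ (sum_le_sum fun i _ => ?_) (sum_nonneg fun i _ => hwt0 _)
    exact (mul_le_mul_of_nonneg_left (indicator_one_le_one _ _) (hwt0 _)).trans_eq (mul_one _)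
  · exact div_le_div_of_nonneg_right
      (sum_le_sum fun i _ => mul_le_mul_of_nonneg_left (indicator_Iic_le_Iio hst _) (hwt0 _))
      (sum_nonneg fun i _ => hwt0 _)

end Reweighted

/-! ## §4 Two codes: their printed distribution functions agree uniformly -/

section TwoCodes

variable {Ω : Type*} [MeasurableSpace Ω] {P : Measure Ω}
variable {Ω' : Type*} [MeasurableSpace Ω'] {P' : Measure Ω'}
variable {X : Type*} [MeasurableSpace X] {μ : Measure X} {p q q' O : X → ℝ}
variable {y : ℕ → Ω → X} {y' : ℕ → Ω' → X}

/-- **TWO CODES, THE AGREEMENT TABLE AT `ε = 0` FOR A CONTINUOUS STATISTIC: the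
Kolmogorov–Smirnov distance between their printed distribution functions vanishes.**  Codes `A`
and `B` propose from models `q_A, q_B > 0` (measurable) for ONE normalised target `p ≥ 0`, each
along its own independent stream on its own probability space, printing weights with their own
normalisations `c_A, c_B > 0`; `O` a measurable real statistic.  Then for `P_A`-almost every run
of `A` and `P_B`-almost every run of `B`, `sup_t |F̂ₙ^A(t) − F̂ₙ^B(t)| → 0`: both reweighted
empirical distribution functions converge uniformly to the same target distribution function,
which does not depend on the models. [ours] -/
theorem reweightedEDF_AB_agree_ae (hym : ∀ j, Measurable (y j)) (hind : iIndepFun y P)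
    (hlaw : ∀ j, Measure.map (y j) P = μ.withDensity fun z => ENNReal.ofReal (q z))
    (hym' : ∀ j, Measurable (y' j)) (hind' : iIndepFun y' P')
    (hlaw' : ∀ j, Measure.map (y' j) P' = μ.withDensity fun z => ENNReal.ofReal (q' z))
    (hp0 : ∀ z, 0 ≤ p z) (hpm : Measurable p) (hpi : Integrable p μ) (hp1 : ∫ z, p z ∂μ = 1)
    (hq0 : ∀ z, 0 < q z) (hqm : Measurable q) (hq0' : ∀ z, 0 < q' z) (hqm' : Measurable q')
    (hOm : Measurable O) {wt wt' : X → ℝ} {c c' : ℝ} (hc : 0 < c)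
    (hwt : ∀ z, wt z = c * (p z / q z)) (hc' : 0 < c') (hwt' : ∀ z, wt' z = c' * (p z / q' z)) :
    ∀ᵐ ω ∂P, ∀ᵐ ω' ∂P', TendstoUniformly
      (fun (n : ℕ) (t : ℝ) =>
        (∑ i ∈ range n, wt (y i ω) * (Set.Iic t).indicator (1 : ℝ → ℝ) (O (y i ω)))
            / (∑ i ∈ range n, wt (y i ω))
          - (∑ i ∈ range n, wt' (y' i ω') * (Set.Iic t).indicator (1 : ℝ → ℝ) (O (y' i ω')))
            / (∑ i ∈ range n, wt' (y' i ω')))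
      (fun _ => 0) atTop := by
  filter_upwards [reweightedGlivenkoCantelli_ae hym hind hlaw hp0 hpm hpi hp1 hq0 hqm hOm hc hwt]
    with ω hA
  filter_upwards [reweightedGlivenkoCantelli_ae hym' hind' hlaw' hp0 hpm hpi hp1 hq0' hqm' hOm hc'
    hwt'] with ω' hB
  have h := hA.sub hB
  simp only [sub_self] at h
  exact h

end TwoCodes

end Summit.Ventures.LatticeQCDFlow.Scoring.GlivenkoCantelli

end
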